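import Literature.Probability.LatticeModels.RandomCurrentsMixingCore
import HarnessLib

/-!
# The endgame of the mixing property of random currents (Aizenman–Duminil-Copin 2021, Thm 6.4: from (6.16) to (6.8)–(6.9))

Topic `Literature/Probability/LatticeModels`. Theorems and auxiliary definitions only: **no named fact is
introduced** (D-0026).

M. Aizenman, H. Duminil-Copin, Ann. of Math. **194** (2021) = arXiv:1912.07973, §6.2, end of the proof of
**Theorem 6.4** (pp. 25–26: "To conclude the proof is now a matter of elementary algebraic
manipulations"); R. Panis, arXiv:2309.05797, proof of Thm 6.20 (pp. 31–32). Starting from the approximate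
factorisation (6.16) — the tree's `Current.mixingCore` (`RandomCurrentsMixingCore`), here normalised into
probabilities (`Current.srcProb`, `Current.switchWeight`, `Current.mixingCore_prob`: "`|P^{xy}[E ∩ F] -
∑_u δ(u,x,y) P^{xu}[E]P^{uy}[F]| ≤ η`" with `∑_u δ = 1`) — the printed endgame consists of elementary
manipulations of weighted averages, which this file proves as real-variable lemmas:

* `abs_sub_le_of_switch_compare` — **(6.9) for comparable switch weights** ("Since all the `y_i, y'_i` are
  in regular scales … `|δ(u,x,y) - δ(u,x,y')| ≤ C₉s(n/N)^{1/3}δ(u,x,y)`. Therefore (6.9) follows"): two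
  factorisations with weights `δ, δ'`, `|δ - δ'| ≤ κδ` give `|P^{xy}[E] - P^{xy'}[E]| ≤ η + η' + κ`; the same
  lemma serves (6.9b) (moving the inside sources, functional outside);
* `abs_sub_le_of_switch_pivot` — **(6.9) for general far sources through a regular pivot `z`**
  ("`|P^{xy}[E] - P^{xz}[E]| ≤ |P^{xy}[E] - ∑_u δ(u,x,y)P^{xu}[E]| + C₆s/√log(m/n)`");
* `abs_sub_mul_le_of_switch` — **(6.8) from (6.16) and the two relocations** ("we repeat the reasoning …
  applying (6.16) for `E, F, N, n`, the previous inequality for `E`, `m`, `n`, and then again for `F`"):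
  `|P[E∩F] - P[E]P[F]| ≤ η + e_E + e_F`.

No lattice input enters here; the lattice assembly (choice of scales, regular scales, Lemma 6.7 and the
second-moment bounds in the boxes `Λ_L`) is the business of the companion files.

## References

* M. Aizenman, H. Duminil-Copin, Ann. of Math. 194 (2021), arXiv:1912.07973, §6.2, (6.16) and the end of
  the proof of Thm 6.4 (pp. 25–26) [AizenmanDuminilCopinAnnals2021].
* R. Panis, arXiv:2309.05797 (2023), §6.4, proof of Thm 6.20, displays (6.10)–(6.13) [Panis2023Triviality].

## Mathlib

`Finset.sum`, `abs_sub_le`, `Finset.abs_sum_le_sum_abs`, `ENNReal.toReal` algebra.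
-/

noncomputable section

open Finset Filter
open scoped symmDiff ENNReal

namespace Literature.Probability.LatticeModels

/-! ### Part 1. Weighted averages: the elementary manipulations -/

section WeightedAverages

variable {ι : Type*}

/-- A weighted average of quantities within `θ` of `Q` is within `θ` of `Q` (weights `≥ 0` of total mass
`1`). [folklore] -/
theorem abs_weighted_sub_const_le (s : Finset ι) {δ f : ι → ℝ} {Q θ : ℝ} (hδ0 : ∀ i ∈ s, 0 ≤ δ i)
    (hδ1 : ∑ i ∈ s, δ i = 1) (hf : ∀ i ∈ s, δ i ≠ 0 → |f i - Q| ≤ θ) :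
    |∑ i ∈ s, δ i * f i - Q| ≤ θ := by
  have hQ : Q = ∑ i ∈ s, δ i * Q := by rw [← Finset.sum_mul, hδ1, one_mul]
  have hθ : 0 ≤ θ ∨ ∀ i ∈ s, δ i = 0 := by
    by_cases h : ∃ i ∈ s, δ i ≠ 0
    · obtain ⟨i, hi, hne⟩ := h
      exact Or.inl ((abs_nonneg _).trans (hf i hi hne))
    · push Not at h
      exact Or.inr h
  rcases hθ with hθ | hzero
  · calc |∑ i ∈ s, δ i * f i - Q| = |∑ i ∈ s, δ i * (f i - Q)| := by
          rw [hQ, ← Finset.sum_sub_distrib]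
          congr 1
          refine Finset.sum_congr rfl fun i _ => by rw [← hQ]; ring
      _ ≤ ∑ i ∈ s, |δ i * (f i - Q)| := Finset.abs_sum_le_sum_abs _ _
      _ ≤ ∑ i ∈ s, δ i * θ := by
          refine Finset.sum_le_sum fun i hi => ?_
          rw [abs_mul, abs_of_nonneg (hδ0 i hi)]
          by_cases hne : δ i = 0
          · rw [hne, zero_mul, zero_mul]
          · exact mul_le_mul_of_nonneg_left (hf i hi hne) (hδ0 i hi)
      _ = θ := by rw [← Finset.sum_mul, hδ1, one_mul]
  · exfalso
    have : ∑ i ∈ s, δ i = 0 := Finset.sum_eq_zero hzero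
    rw [hδ1] at this
    exact one_ne_zero this

/-- Two weighted averages of the same `[0,1]`-valued quantities, with comparable weights
`|δ - δ'| ≤ κδ`, differ by at most `κ`. [folklore] -/
theorem abs_weighted_sub_weighted_le (s : Finset ι) {δ δ' f : ι → ℝ} {κ : ℝ}
    (hδ1 : ∑ i ∈ s, δ i = 1) (hcomp : ∀ i ∈ s, |δ i - δ' i| ≤ κ * δ i) (hf0 : ∀ i ∈ s, 0 ≤ f i)
    (hf1 : ∀ i ∈ s, f i ≤ 1) :
    |∑ i ∈ s, δ i * f i - ∑ i ∈ s, δ' i * f i| ≤ κ := by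
  calc |∑ i ∈ s, δ i * f i - ∑ i ∈ s, δ' i * f i| = |∑ i ∈ s, (δ i - δ' i) * f i| := by
        rw [← Finset.sum_sub_distrib]
        congr 1
        exact Finset.sum_congr rfl fun i _ => by ring
    _ ≤ ∑ i ∈ s, |(δ i - δ' i) * f i| := Finset.abs_sum_le_sum_abs _ _
    _ ≤ ∑ i ∈ s, κ * δ i := by
        refine Finset.sum_le_sum fun i hi => ?_
        rw [abs_mul, abs_of_nonneg (hf0 i hi)]
        calc |δ i - δ' i| * f i ≤ κ * δ i * f i := mul_le_mul_of_nonneg_right (hcomp i hi) (hf0 i hi)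
          _ ≤ κ * δ i * 1 := by
              have hκδ : 0 ≤ κ * δ i := (abs_nonneg _).trans (hcomp i hi)
              exact mul_le_mul_of_nonneg_left (hf1 i hi) hκδ
          _ = κ * δ i := mul_one _
    _ = κ := by rw [← Finset.mul_sum, hδ1, mul_one]

/-- `|ab - a'b'| ≤ |a - a'| + |b - b'|` for `a, a', b, b' ∈ [0,1]`. [folklore] -/
theorem abs_mul_sub_mul_le_unit {a a' b b' : ℝ} (ha : 0 ≤ a) (ha1 : a ≤ 1) (hb' : 0 ≤ b') (hb'1 : b' ≤ 1) :
    |a * b - a' * b'| ≤ |a - a'| + |b - b'| := by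
  calc |a * b - a' * b'| = |a * (b - b') + (a - a') * b'| := by ring_nf
    _ ≤ |a * (b - b')| + |(a - a') * b'| := abs_add_le _ _
    _ = a * |b - b'| + |a - a'| * b' := by rw [abs_mul, abs_mul, abs_of_nonneg ha, abs_of_nonneg hb']
    _ ≤ 1 * |b - b'| + |a - a'| * 1 :=
        add_le_add (mul_le_mul_of_nonneg_right ha1 (abs_nonneg _)) (mul_le_mul_of_nonneg_left hb'1 (abs_nonneg _))
    _ = |a - a'| + |b - b'| := by ring

/-- **(6.9) for comparable switch weights** (Aizenman–Duminil-Copin 2021, p. 25: "apply twice (once for `𝐲`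
and once for `𝐲'`) the previous inequality [(6.16)] for our event `E` and the event on the outside being
the full event … `|δ(u,x,y) - δ(u,x,y')| ≤ C₉s(n/N)^{1/3}δ(u,x,y)`. Therefore, (6.9) follows"): if
`|P - ∑ δf| ≤ η`, `|P' - ∑ δ'f| ≤ η'` and `|δ - δ'| ≤ κδ` with `∑δ = 1`, `f ∈ [0,1]`, then
`|P - P'| ≤ η + η' + κ`. [cite: AizenmanDuminilCopinAnnals2021, arXiv:1912.07973 §6.2, proof of Thm 6.4, derivation of (6.9) (p. 25)] -/
theorem abs_sub_le_of_switch_compare (s : Finset ι) {δ δ' f : ι → ℝ} {P P' η η' κ : ℝ}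
    (hδ1 : ∑ i ∈ s, δ i = 1) (hcomp : ∀ i ∈ s, |δ i - δ' i| ≤ κ * δ i)
    (hf0 : ∀ i ∈ s, 0 ≤ f i) (hf1 : ∀ i ∈ s, f i ≤ 1)
    (hP : |P - ∑ i ∈ s, δ i * f i| ≤ η) (hP' : |P' - ∑ i ∈ s, δ' i * f i| ≤ η') :
    |P - P'| ≤ η + η' + κ := by
  have h := abs_weighted_sub_weighted_le s hδ1 hcomp hf0 hf1
  calc |P - P'| = |(P - ∑ i ∈ s, δ i * f i) + (∑ i ∈ s, δ i * f i - ∑ i ∈ s, δ' i * f i) -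
        (P' - ∑ i ∈ s, δ' i * f i)| := by ring_nf
    _ ≤ |(P - ∑ i ∈ s, δ i * f i) + (∑ i ∈ s, δ i * f i - ∑ i ∈ s, δ' i * f i)| + |P' - ∑ i ∈ s, δ' i * f i| :=
        abs_sub _ _
    _ ≤ |P - ∑ i ∈ s, δ i * f i| + |∑ i ∈ s, δ i * f i - ∑ i ∈ s, δ' i * f i| + |P' - ∑ i ∈ s, δ' i * f i| :=
        add_le_add (abs_add_le _ _) le_rfl
    _ ≤ η + κ + η' := add_le_add (add_le_add hP h) hP'
    _ = η + η' + κ := by ring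

/-- **(6.9) for general far sources through a regular pivot** (Aizenman–Duminil-Copin 2021, p. 26:
"`|P^{xy}[E] - P^{xz}[E]| = |P^{xy}[E] - ∑_u δ(u,x,y)P^{xz}[E]| ≤ |P^{xy}[E] - ∑_u δ(u,x,y)P^{xu}[E]| +
C₆s/√log(m/n)`"): if `|P - ∑ δf| ≤ η` and `|f(u) - Q| ≤ θ` on the support of `δ` (`∑δ = 1`), then
`|P - Q| ≤ η + θ`. [cite: AizenmanDuminilCopinAnnals2021, arXiv:1912.07973 §6.2, proof of Thm 6.4, the display for |P^{xy}[E] − P^{xz}[E]| (p. 26)] -/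
theorem abs_sub_le_of_switch_pivot (s : Finset ι) {δ f : ι → ℝ} {P Q η θ : ℝ} (hδ0 : ∀ i ∈ s, 0 ≤ δ i)
    (hδ1 : ∑ i ∈ s, δ i = 1) (hP : |P - ∑ i ∈ s, δ i * f i| ≤ η) (hf : ∀ i ∈ s, δ i ≠ 0 → |f i - Q| ≤ θ) :
    |P - Q| ≤ η + θ := by
  have h := abs_weighted_sub_const_le s hδ0 hδ1 hf
  calc |P - Q| = |(P - ∑ i ∈ s, δ i * f i) + (∑ i ∈ s, δ i * f i - Q)| := by ring_nf
    _ ≤ |P - ∑ i ∈ s, δ i * f i| + |∑ i ∈ s, δ i * f i - Q| := abs_add_le _ _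
    _ ≤ η + θ := add_le_add hP h

/-- **(6.8) from (6.16) and the two relocations** (Aizenman–Duminil-Copin 2021, p. 26: "For `N ≥ n^{9α₀}`,
the proof of (6.8) is obtained by applying (6.16) for `E`, `F`, `N` and `n`, the previous inequality for
`E`, `m` and `n` …, and then again (6.16) for `F`"): if `|P_{EF} - ∑_u δ(u) f(u)g(u)| ≤ η`, each `f(u)` is
within `e_E` of `P_E`, each `g(u)` within `e_F` of `P_F` (all in `[0,1]`, `∑δ = 1`), then
`|P_{EF} - P_E P_F| ≤ η + e_E + e_F`. [cite: AizenmanDuminilCopinAnnals2021, arXiv:1912.07973 §6.2, proof of Thm 6.4, last paragraph (p. 26)] -/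
theorem abs_sub_mul_le_of_switch (s : Finset ι) {δ f g : ι → ℝ} {PEF PE PF η eE eF : ℝ}
    (hδ0 : ∀ i ∈ s, 0 ≤ δ i) (hδ1 : ∑ i ∈ s, δ i = 1)
    (hP : |PEF - ∑ i ∈ s, δ i * (f i * g i)| ≤ η)
    (hf : ∀ i ∈ s, δ i ≠ 0 → |f i - PE| ≤ eE) (hg : ∀ i ∈ s, δ i ≠ 0 → |g i - PF| ≤ eF)
    (hf0 : ∀ i ∈ s, 0 ≤ f i) (hf1 : ∀ i ∈ s, f i ≤ 1) (hPF0 : 0 ≤ PF) (hPF1 : PF ≤ 1) :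
    |PEF - PE * PF| ≤ η + eE + eF := by
  have hprod : ∀ i ∈ s, δ i ≠ 0 → |f i * g i - PE * PF| ≤ eE + eF := fun i hi hne =>
    (abs_mul_sub_mul_le_unit (hf0 i hi) (hf1 i hi) hPF0 hPF1).trans (add_le_add (hf i hi hne) (hg i hi hne))
  have h := abs_sub_le_of_switch_pivot s (f := fun i => f i * g i) hδ0 hδ1 hP hprod
  linarith

end WeightedAverages

/-! ### Part 2. Normalised probabilities and switch weights; (6.16) in normalised form -/

namespace Current

variable {V : Type*} [Fintype V] [DecidableEq V] {G : SimpleGraph V} [DecidableRel G.Adj]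
variable {K : G.edgeFinset → ℝ}

variable (K) in
/-- The probability of a `[0,1]`-valued functional of the four currents under `P^{A₁,A₂,∅,∅}` (sourced
current second in each pair): `srcMass/srcNrm` as a real number (junk `0` if the normalisation vanishes).
[cite: AizenmanDuminilCopinAnnals2021, arXiv:1912.07973 §6.2, the measures P^{xy} (p. 23)] -/
def srcProb (A₁ A₂ : Finset V) (Θ : FourCfg G → ℝ≥0∞) : ℝ :=
  (srcMass K A₁ A₂ Θ).toReal / (srcNrm K A₁ A₂).toReal

variable (K) in
/-- **The switch weights `δ(u, x, y)`** of Aizenman–Duminil-Copin 2021 (p. 25: "`δ(u,x,y) :=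
∏ᵢ a_{x_i,y_i}(u_i)/(|𝒦| A_{x_i,y_i}(2^{k_i}))`"), for abstract coefficients `c₁, c₂`:
`δ(v₁,v₂) = c₁(v₁)c₂(v₂) · Nrm^{xv}Nrm^{vy}/(Nrm^{xy} Z[∅]⁴)` (`= c₁(v₁)c₂(v₂) ã₁(v₁) ã₂(v₂)` with
`ãᵢ(v) = Z[x_iv]Z[vy_i]/(Z[x_iy_i]Z[∅])` the finite-volume `a_{x_i,y_i}(v)`), as a real number.
[cite: AizenmanDuminilCopinAnnals2021, arXiv:1912.07973 §6.2, definition of δ(u,x,y) (p. 25)] -/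
def switchWeight (x₁ x₂ y₁ y₂ : V) (c₁ c₂ : V → ℝ≥0∞) (v₁ v₂ : V) : ℝ :=
  (c₁ v₁ * c₂ v₂ * (srcNrm K ({x₁} ∆ {v₁}) ({x₂} ∆ {v₂}) * srcNrm K ({v₁} ∆ {y₁}) ({v₂} ∆ {y₂}))).toReal /
    (srcNrm K ({x₁} ∆ {y₁}) ({x₂} ∆ {y₂}) * ecurrentSum K ∅ ^ 4).toReal

/-- `0 ≤ srcProb`. [folklore] -/
theorem srcProb_nonneg (K : G.edgeFinset → ℝ) (A₁ A₂ : Finset V) (Θ : FourCfg G → ℝ≥0∞) : 0 ≤ srcProb K A₁ A₂ Θ :=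
  div_nonneg ENNReal.toReal_nonneg ENNReal.toReal_nonneg

/-- `srcProb Θ ≤ 1` for `Θ ≤ 1` (`K ≥ 0`). [folklore] -/
theorem srcProb_le_one (hK : ∀ e, 0 ≤ K e) (A₁ A₂ : Finset V) {Θ : FourCfg G → ℝ≥0∞} (hΘ : ∀ pq, Θ pq ≤ 1) :
    srcProb K A₁ A₂ Θ ≤ 1 := by
  unfold srcProb
  have hNtop : srcNrm K A₁ A₂ ≠ ∞ := by
    unfold srcNrm
    exact ENNReal.mul_ne_top (ENNReal.mul_ne_top (ecurrentSum_ne_top hK _) (ecurrentSum_ne_top hK _))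
      (ENNReal.mul_ne_top (ecurrentSum_ne_top hK _) (ecurrentSum_ne_top hK _))
  have hle := ENNReal.toReal_mono hNtop (srcMass_le_srcNrm K A₁ A₂ hΘ)
  rcases eq_or_lt_of_le (ENNReal.toReal_nonneg : 0 ≤ (srcNrm K A₁ A₂).toReal) with h0 | hpos
  · rw [← h0, div_zero]; exact zero_le_one
  · rwa [div_le_one hpos]

/-- `srcProb 1 = 1` when the normalisation does not vanish. [folklore] -/
theorem srcProb_one (hK : ∀ e, 0 ≤ K e) {A₁ A₂ : Finset V} (hN : srcNrm K A₁ A₂ ≠ 0) :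
    srcProb K A₁ A₂ (fun _ => 1) = 1 := by
  unfold srcProb
  rw [srcMass_one]
  have hNtop : srcNrm K A₁ A₂ ≠ ∞ := by
    unfold srcNrm
    exact ENNReal.mul_ne_top (ENNReal.mul_ne_top (ecurrentSum_ne_top hK _) (ecurrentSum_ne_top hK _))
      (ENNReal.mul_ne_top (ecurrentSum_ne_top hK _) (ecurrentSum_ne_top hK _))
  exact div_self (ENNReal.toReal_pos hN hNtop).ne'

/-- `0 ≤ switchWeight`. [folklore] -/
theorem switchWeight_nonneg (K : G.edgeFinset → ℝ) (x₁ x₂ y₁ y₂ : V) (c₁ c₂ : V → ℝ≥0∞) (v₁ v₂ : V) :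
    0 ≤ switchWeight K x₁ x₂ y₁ y₂ c₁ c₂ v₁ v₂ :=
  div_nonneg ENNReal.toReal_nonneg ENNReal.toReal_nonneg

/-- The switched normalisations: `Nrm^{xv} Nrm^{vy} = ∑ W_sw(v)`. [folklore] -/
theorem srcNrm_mul_srcNrm_eq_tsum_octoWeightSw (K : G.edgeFinset → ℝ) (w x₁ x₂ y₁ y₂ v₁ v₂ : V) :
    srcNrm K ({x₁} ∆ {v₁}) ({x₂} ∆ {v₂}) * srcNrm K ({v₁} ∆ {y₁}) ({v₂} ∆ {y₂}) =
      ∑' ω : OctoCfg G, octoWeightSw K w x₁ x₂ y₁ y₂ v₁ v₂ ω := by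
  rw [tsum_octoWeightSw]
  unfold srcNrm
  ring

/-- **`∑_u δ(u,x,y) = 1`** (for coefficients of mean one and a non-vanishing normalisation).
[cite: AizenmanDuminilCopinAnnals2021, arXiv:1912.07973 §6.2, "the sum on (u₁,…,u_t) of δ(u,x,y) is 1" (p. 25)] -/
theorem sum_switchWeight_eq_one (hK : ∀ e, 0 ≤ K e) (x₁ x₂ y₁ y₂ : V) {c₁ c₂ : V → ℝ≥0∞}
    (h₁ : ∀ v, c₁ v ≠ ∞) (h₂ : ∀ v, c₂ v ≠ ∞)
    (hc₁ : ∑ v, c₁ v * (ecurrentSum K ({x₁} ∆ {v}) * ecurrentSum K ({v} ∆ {y₁})) =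
      ecurrentSum K ({x₁} ∆ {y₁}) * ecurrentSum K ∅)
    (hc₂ : ∑ v, c₂ v * (ecurrentSum K ({x₂} ∆ {v}) * ecurrentSum K ({v} ∆ {y₂})) =
      ecurrentSum K ({x₂} ∆ {y₂}) * ecurrentSum K ∅)
    (hN : srcNrm K ({x₁} ∆ {y₁}) ({x₂} ∆ {y₂}) ≠ 0) :
    ∑ v₁, ∑ v₂, switchWeight K x₁ x₂ y₁ y₂ c₁ c₂ v₁ v₂ = 1 := by
  have hZtop : ∀ A, ecurrentSum K A ≠ ∞ := fun A => ecurrentSum_ne_top hK A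
  have hZ0 : ecurrentSum K (∅ : Finset V) ≠ 0 := ecurrentSum_empty_ne_zero K
  have hNtop : ∀ A₁ A₂ : Finset V, srcNrm K A₁ A₂ ≠ ∞ := fun A₁ A₂ => by
    unfold srcNrm
    exact ENNReal.mul_ne_top (ENNReal.mul_ne_top (hZtop _) (hZtop _)) (ENNReal.mul_ne_top (hZtop _) (hZtop _))
  set N8 : ℝ≥0∞ := srcNrm K ({x₁} ∆ {y₁}) ({x₂} ∆ {y₂}) * ecurrentSum K ∅ ^ 4 with hN8
  have hN8top : N8 ≠ ∞ := ENNReal.mul_ne_top (hNtop _ _) (ENNReal.pow_ne_top (hZtop _))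
  have hN80 : N8 ≠ 0 := mul_ne_zero hN (pow_ne_zero 4 hZ0)
  have hN8pos : 0 < N8.toReal := ENNReal.toReal_pos hN80 hN8top
  unfold switchWeight
  rw [← hN8]
  simp_rw [div_eq_mul_inv, ← Finset.sum_mul]
  have hTtop : ∀ v₁ v₂, c₁ v₁ * c₂ v₂ *
      (srcNrm K ({x₁} ∆ {v₁}) ({x₂} ∆ {v₂}) * srcNrm K ({v₁} ∆ {y₁}) ({v₂} ∆ {y₂})) ≠ ∞ := fun v₁ v₂ =>
    ENNReal.mul_ne_top (ENNReal.mul_ne_top (h₁ _) (h₂ _)) (ENNReal.mul_ne_top (hNtop _ _) (hNtop _ _))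
  have hinner : ∀ v₁, ∑ v₂, (c₁ v₁ * c₂ v₂ *
      (srcNrm K ({x₁} ∆ {v₁}) ({x₂} ∆ {v₂}) * srcNrm K ({v₁} ∆ {y₁}) ({v₂} ∆ {y₂}))).toReal =
      (∑ v₂, c₁ v₁ * c₂ v₂ *
        (srcNrm K ({x₁} ∆ {v₁}) ({x₂} ∆ {v₂}) * srcNrm K ({v₁} ∆ {y₁}) ({v₂} ∆ {y₂}))).toReal := fun v₁ =>
    (ENNReal.toReal_sum fun v₂ _ => hTtop v₁ v₂).symm
  have houter : ∑ v₁, (∑ v₂, c₁ v₁ * c₂ v₂ *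
      (srcNrm K ({x₁} ∆ {v₁}) ({x₂} ∆ {v₂}) * srcNrm K ({v₁} ∆ {y₁}) ({v₂} ∆ {y₂}))).toReal =
      (∑ v₁, ∑ v₂, c₁ v₁ * c₂ v₂ *
        (srcNrm K ({x₁} ∆ {v₁}) ({x₂} ∆ {v₂}) * srcNrm K ({v₁} ∆ {y₁}) ({v₂} ∆ {y₂}))).toReal :=
    (ENNReal.toReal_sum fun v₁ _ => ENNReal.sum_ne_top.2 fun v₂ _ => hTtop v₁ v₂).symm
  simp_rw [hinner]
  rw [houter]
  -- the total is `N8` (any vertex serves as the dummy `w`)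
  have htot : ∑ v₁, ∑ v₂, c₁ v₁ * c₂ v₂ * (srcNrm K ({x₁} ∆ {v₁}) ({x₂} ∆ {v₂}) * srcNrm K ({v₁} ∆ {y₁}) ({v₂} ∆ {y₂})) = N8 := by
    simp_rw [srcNrm_mul_srcNrm_eq_tsum_octoWeightSw K x₁ x₁ x₂ y₁ y₂]
    exact sum_mul_tsum_octoWeightSw K x₁ x₁ x₂ y₁ y₂ hc₁ hc₂
  rw [htot]
  exact mul_inv_cancel₀ hN8pos.ne'

/-- **(6.16) normalised.** Under the hypotheses of `Current.mixingCore` (with finite `ρ`, `ε_G` and a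
non-vanishing normalisation `Nrm^{xy}`): for `Φ ≤ 1` local on `E_in`, `Ψ ≤ 1` local on `E_out`,
`|P^{xy}[ΦΨ] - ∑_{u₁,u₂} δ(u) P^{xu}[Φ] P^{uy}[Ψ]| ≤ ρ + ε_G` — "(6.16)".
[cite: AizenmanDuminilCopinAnnals2021, arXiv:1912.07973 §6.2, (6.16) (p. 25)] -/
theorem mixingCore_prob (hK : ∀ e, 0 ≤ K e) (Ein Eout : Finset G.edgeFinset) (w x₁ x₂ y₁ y₂ : V)
    {c₁ c₂ : V → ℝ≥0∞} (h₁ : ∀ v, c₁ v ≠ ∞) (h₂ : ∀ v, c₂ v ≠ ∞)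
    (hc₁ : ∑ v, c₁ v * (ecurrentSum K ({x₁} ∆ {v}) * ecurrentSum K ({v} ∆ {y₁})) =
      ecurrentSum K ({x₁} ∆ {y₁}) * ecurrentSum K ∅)
    (hc₂ : ∑ v, c₂ v * (ecurrentSum K ({x₂} ∆ {v}) * ecurrentSum K ({v} ∆ {y₂})) =
      ecurrentSum K ({x₂} ∆ {y₂}) * ecurrentSum K ∅)
    {q₁ q₂ ρ εG : ℝ≥0∞} (hρtop : ρ ≠ ∞) (hεtop : εG ≠ ∞)
    (hB₁ : ecurrentSum K ∅ * ∑' p : Current G × Current G, epairWeight K ({x₁} ∆ {y₁}) ∅ p * nPair x₁ c₁ (p.1 + p.2) ^ 2 ≤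
      q₁ * (ecurrentSum K ({x₁} ∆ {y₁}) * ecurrentSum K ∅ ^ 2))
    (hB₂ : ecurrentSum K ∅ * ∑' p : Current G × Current G, epairWeight K ({x₂} ∆ {y₂}) ∅ p * nPair x₂ c₂ (p.1 + p.2) ^ 2 ≤
      q₂ * (ecurrentSum K ({x₂} ∆ {y₂}) * ecurrentSum K ∅ ^ 2))
    (hρ : q₁ * q₂ ≤ 1 + ρ ^ 2)
    (hG : ∀ v₁ v₂, c₁ v₁ ≠ 0 → c₂ v₂ ≠ 0 →
      ∑' ω : OctoCfg G, octoWeightSw K w x₁ x₂ y₁ y₂ v₁ v₂ ω * splitFailInd Ein Eout (octoU w v₁ v₂) (octoY w y₁ y₂) ω ≤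
        εG * ∑' ω : OctoCfg G, octoWeightSw K w x₁ x₂ y₁ y₂ v₁ v₂ ω)
    (hN : srcNrm K ({x₁} ∆ {y₁}) ({x₂} ∆ {y₂}) ≠ 0)
    {Φ Ψ : FourCfg G → ℝ≥0∞} (hΦ1 : ∀ pq, Φ pq ≤ 1) (hΨ1 : ∀ pq, Ψ pq ≤ 1)
    (hΦ : FourLocal Ein Φ) (hΨ : FourLocal Eout Ψ) :
    |srcProb K ({x₁} ∆ {y₁}) ({x₂} ∆ {y₂}) (Φ * Ψ) -
      ∑ v₁, ∑ v₂, switchWeight K x₁ x₂ y₁ y₂ c₁ c₂ v₁ v₂ *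
        (srcProb K ({x₁} ∆ {v₁}) ({x₂} ∆ {v₂}) Φ * srcProb K ({v₁} ∆ {y₁}) ({v₂} ∆ {y₂}) Ψ)| ≤
      ρ.toReal + εG.toReal := by
  have hZtop : ∀ A, ecurrentSum K A ≠ ∞ := fun A => ecurrentSum_ne_top hK A
  have hZ0 : ecurrentSum K (∅ : Finset V) ≠ 0 := ecurrentSum_empty_ne_zero K
  have hNtop : ∀ A₁ A₂ : Finset V, srcNrm K A₁ A₂ ≠ ∞ := fun A₁ A₂ => by
    unfold srcNrm
    exact ENNReal.mul_ne_top (ENNReal.mul_ne_top (hZtop _) (hZtop _)) (ENNReal.mul_ne_top (hZtop _) (hZtop _))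
  have hMtop : ∀ (A₁ A₂ : Finset V) {Θ : FourCfg G → ℝ≥0∞}, (∀ pq, Θ pq ≤ 1) → srcMass K A₁ A₂ Θ ≠ ∞ :=
    fun A₁ A₂ Θ hΘ => ne_top_of_le_ne_top (hNtop A₁ A₂) (srcMass_le_srcNrm K A₁ A₂ hΘ)
  set N8 : ℝ≥0∞ := srcNrm K ({x₁} ∆ {y₁}) ({x₂} ∆ {y₂}) * ecurrentSum K ∅ ^ 4 with hN8
  have hN8top : N8 ≠ ∞ := ENNReal.mul_ne_top (hNtop _ _) (ENNReal.pow_ne_top (hZtop _))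
  have hN80 : N8 ≠ 0 := mul_ne_zero hN (pow_ne_zero 4 hZ0)
  have hN8pos : 0 < N8.toReal := ENNReal.toReal_pos hN80 hN8top
  obtain ⟨hup, hdown⟩ := mixingCore hK Ein Eout w x₁ x₂ y₁ y₂ h₁ h₂ hc₁ hc₂ hB₁ hB₂ hρ hG hΦ1 hΨ1 hΦ hΨ
  rw [← hN8] at hup hdown
  have hΦΨ1 : ∀ pq, (Φ * Ψ) pq ≤ 1 := fun pq => by
    rw [Pi.mul_apply]; exact (mul_le_mul' (hΦ1 pq) (hΨ1 pq)).trans (le_of_eq (one_mul 1))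
  -- the main quantity `S = ∑ c₁c₂ M^{xv}[Φ]M^{vy}[Ψ]` and its normalised value
  set S : ℝ≥0∞ := ∑ v₁, ∑ v₂, c₁ v₁ * c₂ v₂ *
    (srcMass K ({x₁} ∆ {v₁}) ({x₂} ∆ {v₂}) Φ * srcMass K ({v₁} ∆ {y₁}) ({v₂} ∆ {y₂}) Ψ) with hS
  have hSterm_top : ∀ v₁ v₂, c₁ v₁ * c₂ v₂ *
      (srcMass K ({x₁} ∆ {v₁}) ({x₂} ∆ {v₂}) Φ * srcMass K ({v₁} ∆ {y₁}) ({v₂} ∆ {y₂}) Ψ) ≠ ∞ := fun v₁ v₂ =>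
    ENNReal.mul_ne_top (ENNReal.mul_ne_top (h₁ _) (h₂ _)) (ENNReal.mul_ne_top (hMtop _ _ hΦ1) (hMtop _ _ hΨ1))
  have hStop : S ≠ ∞ := ENNReal.sum_ne_top.2 fun v₁ _ => ENNReal.sum_ne_top.2 fun v₂ _ => hSterm_top v₁ v₂
  -- term by term: `(c₁c₂ M M).toReal / N8 = δ(v) P^{xv}[Φ] P^{vy}[Ψ]`
  have hterm : ∀ v₁ v₂, (c₁ v₁ * c₂ v₂ *
      (srcMass K ({x₁} ∆ {v₁}) ({x₂} ∆ {v₂}) Φ * srcMass K ({v₁} ∆ {y₁}) ({v₂} ∆ {y₂}) Ψ)).toReal / N8.toReal =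
      switchWeight K x₁ x₂ y₁ y₂ c₁ c₂ v₁ v₂ *
        (srcProb K ({x₁} ∆ {v₁}) ({x₂} ∆ {v₂}) Φ * srcProb K ({v₁} ∆ {y₁}) ({v₂} ∆ {y₂}) Ψ) := by
    intro v₁ v₂
    unfold switchWeight srcProb
    rw [← hN8]
    -- `M = P · Nrm` for each factor (or both sides vanish)
    set Nxv := srcNrm K ({x₁} ∆ {v₁}) ({x₂} ∆ {v₂}) with hNxv
    set Nvy := srcNrm K ({v₁} ∆ {y₁}) ({v₂} ∆ {y₂}) with hNvy
    set Mxv := srcMass K ({x₁} ∆ {v₁}) ({x₂} ∆ {v₂}) Φ with hMxv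
    set Mvy := srcMass K ({v₁} ∆ {y₁}) ({v₂} ∆ {y₂}) Ψ with hMvy
    have hMxv_le : Mxv ≤ Nxv := srcMass_le_srcNrm K _ _ hΦ1
    have hMvy_le : Mvy ≤ Nvy := srcMass_le_srcNrm K _ _ hΨ1
    simp only [ENNReal.toReal_mul]
    by_cases hx0 : Nxv.toReal = 0
    · have : Mxv.toReal = 0 := le_antisymm (hx0 ▸ ENNReal.toReal_mono (hNtop _ _) hMxv_le) ENNReal.toReal_nonneg
      rw [this, hx0]; simp
    by_cases hy0 : Nvy.toReal = 0
    · have : Mvy.toReal = 0 := le_antisymm (hy0 ▸ ENNReal.toReal_mono (hNtop _ _) hMvy_le) ENNReal.toReal_nonneg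
      rw [this, hy0]; simp
    field_simp
  have hSreal : S.toReal / N8.toReal = ∑ v₁, ∑ v₂, switchWeight K x₁ x₂ y₁ y₂ c₁ c₂ v₁ v₂ *
      (srcProb K ({x₁} ∆ {v₁}) ({x₂} ∆ {v₂}) Φ * srcProb K ({v₁} ∆ {y₁}) ({v₂} ∆ {y₂}) Ψ) := by
    rw [hS, ENNReal.toReal_sum (fun v₁ _ => ENNReal.sum_ne_top.2 fun v₂ _ => hSterm_top v₁ v₂), Finset.sum_div]
    refine Finset.sum_congr rfl fun v₁ _ => ?_
    rw [ENNReal.toReal_sum (fun v₂ _ => hSterm_top v₁ v₂), Finset.sum_div]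
    exact Finset.sum_congr rfl fun v₂ _ => hterm v₁ v₂
  have hPreal : srcProb K ({x₁} ∆ {y₁}) ({x₂} ∆ {y₂}) (Φ * Ψ) =
      (srcMass K ({x₁} ∆ {y₁}) ({x₂} ∆ {y₂}) (Φ * Ψ) * ecurrentSum K ∅ ^ 4).toReal / N8.toReal := by
    unfold srcProb
    rw [hN8, ENNReal.toReal_mul, ENNReal.toReal_mul]
    have hZ4 : (ecurrentSum K (∅ : Finset V) ^ 4).toReal ≠ 0 :=
      (ENNReal.toReal_pos (pow_ne_zero 4 hZ0) (ENNReal.pow_ne_top (hZtop _))).ne'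
    rw [mul_div_mul_right _ _ hZ4]
  -- the two one-sided inequalities, in `ℝ`
  have hE : ((ρ + εG) * N8).toReal = (ρ.toReal + εG.toReal) * N8.toReal := by
    rw [ENNReal.toReal_mul, ENNReal.toReal_add hρtop hεtop]
  have hEtop : (ρ + εG) * N8 ≠ ∞ := ENNReal.mul_ne_top (ENNReal.add_ne_top.2 ⟨hρtop, hεtop⟩) hN8top
  have hMZtop : srcMass K ({x₁} ∆ {y₁}) ({x₂} ∆ {y₂}) (Φ * Ψ) * ecurrentSum K ∅ ^ 4 ≠ ∞ :=
    ENNReal.mul_ne_top (hMtop _ _ hΦΨ1) (ENNReal.pow_ne_top (hZtop _))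
  have hup' := ENNReal.toReal_mono (ENNReal.add_ne_top.2 ⟨hStop, hEtop⟩) hup
  have hdown' := ENNReal.toReal_mono (ENNReal.add_ne_top.2 ⟨hMZtop, hEtop⟩) hdown
  rw [ENNReal.toReal_add hStop hEtop, hE] at hup'
  rw [ENNReal.toReal_add hMZtop hEtop, hE] at hdown'
  rw [hPreal, ← hSreal, abs_sub_le_iff]
  constructor
  · rw [← sub_div, div_le_iff₀ hN8pos]; linarith
  · rw [← sub_div, div_le_iff₀ hN8pos]; linarith

end Current

end Literature.Probability.LatticeModels
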